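import Literature.Topology.FourManifolds.TrisectionsFaceCharts
import Literature.Topology.FourManifolds.TrisectionsCornerHadamard
import Literature.Topology.FourManifolds.MorseProofs
import Mathlib.Geometry.Manifold.PartitionOfUnity
import HarnessLib

/-!
# The ambient function of a face of a trisection: extension and collar form

Topic `Literature/Topology/FourManifolds`; infrastructure for the fact seat
`provefact-Literature.Topology.FourManifolds.exists-14560f9fc8` (named fact (c′)
`Literature.Topology.FourManifolds.exists_stabilized_gkTrisection`, Gay–Kirby 2016, Def. 8 and
Lemma 10; here the faces `H_{ab} = S a ∩ S b` of clause (iii) of Def. 1).  Everything in this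
file is **proved**; no definitions, no named facts.

Given the handlebody `e : H → X` of a face (a smooth embedding of a compact `3`-manifold with
boundary, image `Q`, boundary image `F`) and its adapted Morse function `f`, this file builds
smooth ambient functions on the closed `4`-manifold `X`:

* `exists_contMDiff_extension_face_global` — `G₁` with `G₁ ∘ e = f` (local Seeley extensions
  `exists_contMDiffOn_extension_face` glued under a pointwise convex constraint by Mathlib's
  `exists_contMDiffMap_forall_mem_convex_of_local`);
* `exists_faceHadamard_local` — in a corner-slice chart of the sector at a point of `F`,
  `1 - G₁ = u_a · B + v_a · A` with `A, B` smooth (Hadamard's lemma in the two normal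
  coordinates, `eq_smul_integral_add_smul_integral_of_stratum`), so that on the face
  (`u_a = 0`) `1 - G₁ = v_a · A`.

## References

* D. Gay, R. Kirby, *Trisecting 4-manifolds*, Geom. Topol. 20 (2016), Def. 1. [GayKirby2016]
* J. Milnor, *Morse theory* (1963), Lemma 2.1 (Hadamard). [Milnor1963]
* R. T. Seeley, *Extension of `C^∞` functions defined in a half space* (1964). [Seeley1964]
-/

open scoped Manifold ContDiff Topology
open Set Function Filter

noncomputable section

namespace Literature.Topology.FourManifolds

universe u

section FaceAmbient

variable {X : Type u} [TopologicalSpace X] [T2Space X] [ChartedSpace (EuclideanSpace ℝ (Fin 4)) X]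
  [IsManifold (𝓡 4) ∞ X]
  {H : Type u} [TopologicalSpace H] [ChartedSpace (EuclideanHalfSpace 3) H]
  [IsManifold (𝓡∂ 3) ∞ H]

/-- **A smooth function on the handlebody of a face extends to the ambient `4`-manifold**:
`G₁ ∘ e = f` for a smooth `G₁ : X → ℝ` (`e` a smooth embedding with closed image).
[cite: Seeley1964, Theorem; LeeSmoothManifolds2013, Lemma 2.26] -/
theorem exists_contMDiff_extension_face_global [SigmaCompactSpace X] {e : H → X}
    (he : Topology.IsEmbedding e) (hclosed : IsClosed (range e))
    (himm : ∀ w, Manifold.IsImmersionAt (𝓡∂ 3) (𝓡 4) ∞ e w)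
    {f : H → ℝ} (hf : ContMDiff (𝓡∂ 3) 𝓘(ℝ, ℝ) ∞ f) :
    ∃ G₁ : X → ℝ, ContMDiff (𝓡 4) 𝓘(ℝ, ℝ) ∞ G₁ ∧ ∀ w, G₁ (e w) = f w := by
  set t : X → Set ℝ := fun y => {r | y ∈ range e → ∀ w, e w = y → r = f w} with ht
  have hconv : ∀ y, Convex ℝ (t y) := by
    intro y
    by_cases hy : y ∈ range e
    · obtain ⟨w, rfl⟩ := hy
      have : t (e w) = {f w} := by
        ext r
        simp only [ht, mem_setOf_eq, mem_singleton_iff]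
        constructor
        · intro h; exact h (mem_range_self w) w rfl
        · rintro rfl - w' hw'; rw [he.injective hw']
      rw [this]; exact convex_singleton _
    · have : t y = univ := by
        ext r; simp only [ht, mem_setOf_eq, mem_univ, iff_true]; exact fun h => absurd h hy
      rw [this]; exact convex_univ
  obtain ⟨g, hg⟩ : ∃ g : C^∞⟮𝓡 4, X; 𝓘(ℝ, ℝ), ℝ⟯, ∀ y, g y ∈ t y := by
    refine exists_contMDiffMap_forall_mem_convex_of_local (I := 𝓡 4) hconv fun y₀ => ?_
    by_cases hy₀ : y₀ ∈ range e
    · obtain ⟨w₀, hw₀⟩ := hy₀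
      obtain ⟨N, F₁, hNo, hwN, hF₁s, hF₁f⟩ := exists_contMDiffOn_extension_face he (himm w₀) hf
      refine ⟨N, hNo.mem_nhds (hw₀ ▸ hwN), F₁, hF₁s, fun y hy _ w hw => ?_⟩
      rw [← hw]; exact hF₁f w (hw ▸ hy)
    · exact ⟨(range e)ᶜ, hclosed.isOpen_compl.mem_nhds hy₀, fun _ => 0, contMDiffOn_const,
        fun y hy hyr => absurd hyr hy⟩
  refine ⟨g, g.contMDiff, fun w => ?_⟩
  exact hg (e w) (mem_range_self w) w rfl

omit [T2Space X] [IsManifold (𝓡 4) ∞ X] in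
/-- **Hadamard in the two normal coordinates at a point of the corner locus (face form).**  If
`G₁` is smooth and equals `1` on `F` near `x₀ ∈ F`, then on a neighbourhood `N` of `x₀`
inside the source of the corner-slice chart `C` (coordinates `(u_a, v_a, t₂, t₃)`),
`1 - G₁ = u_a · B + v_a · A` with `A, B` smooth on `N`, and at the points of `F ∩ N` the
coefficient `A` is the chart derivative `-∂_{v_a} G₁`:
`A y = ∂₁ (1 - G₁ ∘ C.Θ⁻¹) (C.Θ y)`. [cite: Milnor1963, Lemma 2.1] -/
theorem exists_faceHadamard_local {Sa F : Set X} {ua va : X → ℝ} {ρ : X → X}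
    (C : CornerSliceChart Sa F ua va ρ) {G₁ : X → ℝ} (hG₁ : ContMDiff (𝓡 4) 𝓘(ℝ, ℝ) ∞ G₁)
    (hG₁F : ∀ y ∈ C.Θ.source, y ∈ F → G₁ y = 1) {x₀ : X} (hx₀ : x₀ ∈ C.Θ.source) :
    ∃ (N : Set X) (A B : X → ℝ), IsOpen N ∧ x₀ ∈ N ∧ N ⊆ C.Θ.source ∧
      ContMDiffOn (𝓡 4) 𝓘(ℝ, ℝ) ∞ A N ∧ ContMDiffOn (𝓡 4) 𝓘(ℝ, ℝ) ∞ B N ∧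
      (∀ y ∈ N, 1 - G₁ y = ua y * B y + va y * A y) ∧
      ∀ y ∈ N, y ∈ F → A y = fderiv ℝ (fun z => 1 - G₁ (C.Θ.symm z)) (C.Θ y) (EuclideanSpace.single 1 1) := by
  set z₀ : EuclideanSpace ℝ (Fin 4) := C.Θ x₀ with hz₀
  have hz₀T : z₀ ∈ C.Θ.target := C.Θ.map_source hx₀
  obtain ⟨r₁, hr₁, hball⟩ := Metric.isOpen_iff.1 C.Θ.open_target z₀ hz₀T
  -- the chart function `g = 1 - G₁ ∘ Θ⁻¹`, smooth on the target
  set g : EuclideanSpace ℝ (Fin 4) → ℝ := fun z => 1 - G₁ (C.Θ.symm z) with hg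
  have hgs : ContDiffOn ℝ ∞ g C.Θ.target := by
    have h1 : ContMDiffOn 𝓘(ℝ, EuclideanSpace ℝ (Fin 4)) 𝓘(ℝ, ℝ) ∞ (G₁ ∘ C.Θ.symm) C.Θ.target :=
      hG₁.comp_contMDiffOn C.contMDiffOn_symm
    exact contDiffOn_const.sub (contMDiffOn_iff_contDiffOn.1 h1)
  -- globalise with a bump
  set β : ContDiffBump z₀ := ⟨r₁ / 4, r₁ / 2, by linarith, by linarith⟩ with hβ
  set w : EuclideanSpace ℝ (Fin 4) → ℝ := fun z => β z * g z with hw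
  have hws : ContDiff ℝ ∞ w :=
    contDiff_bump_mul' (hgs.mono hball) β (by show r₁ / 2 < r₁; linarith)
  have hweq : ∀ z ∈ Metric.ball z₀ (r₁ / 4), w z = g z := by
    intro z hz
    have : β z = 1 := β.one_of_mem_closedBall (Metric.ball_subset_closedBall hz)
    simp only [hw, this, one_mul]
  -- `w` vanishes on the stratum plane
  have hw0 : ∀ z : EuclideanSpace ℝ (Fin 4), z 0 = 0 → z 1 = 0 → w z = 0 := by
    intro z hz0 hz1
    by_cases hzb : z ∈ Metric.ball z₀ r₁
    · have hzT : z ∈ C.Θ.target := hball hzb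
      have hysrc : C.Θ.symm z ∈ C.Θ.source := C.Θ.map_target hzT
      have hyF : C.Θ.symm z ∈ F := by
        rw [C.mem_K_iff _ hysrc, ← C.apply_zero _ hysrc, ← C.apply_one _ hysrc, C.Θ.right_inv hzT]
        exact ⟨hz0, hz1⟩
      simp only [hw, hg, hG₁F _ hysrc hyF, sub_self, mul_zero]
    · have hzs : z ∉ tsupport β := by
        rw [β.tsupport_eq]
        intro h
        exact hzb (Metric.closedBall_subset_ball (by show r₁ / 2 < r₁; linarith) h)
      simp only [hw, image_eq_zero_of_notMem_tsupport hzs, zero_mul]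
  -- the Hadamard quotients
  set I₀ : EuclideanSpace ℝ (Fin 4) → ℝ := fun x => ∫ s in (0:ℝ)..1, fderiv ℝ w (x - (1 - s) •
      ((x 0) • EuclideanSpace.single (0 : Fin 4) (1:ℝ) +
        (x 1) • EuclideanSpace.single (1 : Fin 4) (1:ℝ))) (EuclideanSpace.single 0 1) with hI₀
  set I₁ : EuclideanSpace ℝ (Fin 4) → ℝ := fun x => ∫ s in (0:ℝ)..1, fderiv ℝ w (x - (1 - s) •
      ((x 0) • EuclideanSpace.single (0 : Fin 4) (1:ℝ) +
        (x 1) • EuclideanSpace.single (1 : Fin 4) (1:ℝ))) (EuclideanSpace.single 1 1) with hI₁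
  have hI₀s : ContDiff ℝ ∞ I₀ := by
    have : ContDiff ℝ ((⊤ : ℕ∞) + 1) w := by exact_mod_cast hws
    have := contDiff_hadamard_integral (n := ⊤) this 0
    exact_mod_cast this
  have hI₁s : ContDiff ℝ ∞ I₁ := by
    have : ContDiff ℝ ((⊤ : ℕ∞) + 1) w := by exact_mod_cast hws
    have := contDiff_hadamard_integral (n := ⊤) this 1
    exact_mod_cast this
  have hHad : ∀ x : EuclideanSpace ℝ (Fin 4), w x = x 0 • I₀ x + x 1 • I₁ x := fun x =>
    eq_smul_integral_add_smul_integral_of_stratum (hws.of_le (by norm_cast)) hw0 x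
  -- the neighbourhood `N`
  set N : Set X := C.Θ.source ∩ C.Θ ⁻¹' Metric.ball z₀ (r₁ / 4) with hN
  have hNo : IsOpen N := C.Θ.continuousOn.isOpen_inter_preimage C.Θ.open_source Metric.isOpen_ball
  have hx₀N : x₀ ∈ N := ⟨hx₀, Metric.mem_ball_self (by linarith)⟩
  have hΘs : ContMDiffOn (𝓡 4) 𝓘(ℝ, EuclideanSpace ℝ (Fin 4)) ∞ C.Θ N :=
    C.contMDiffOn_toFun.mono inter_subset_left
  refine ⟨N, I₁ ∘ C.Θ, I₀ ∘ C.Θ, hNo, hx₀N, inter_subset_left,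
    (contMDiff_iff_contDiff.2 hI₁s).comp_contMDiffOn hΘs,
    (contMDiff_iff_contDiff.2 hI₀s).comp_contMDiffOn hΘs, fun y hy => ?_, fun y hy hyF => ?_⟩
  · -- the identity
    have hysrc : y ∈ C.Θ.source := hy.1
    have h1 : 1 - G₁ y = g (C.Θ y) := by simp only [hg, C.Θ.left_inv hysrc]
    rw [h1, ← hweq _ hy.2, hHad, C.apply_zero y hysrc, C.apply_one y hysrc]
    simp only [comp_apply, smul_eq_mul]
  · -- the value on `F`
    have hysrc : y ∈ C.Θ.source := hy.1
    obtain ⟨hu0, hv0⟩ := (C.mem_K_iff y hysrc).1 hyF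
    have hz0 : C.Θ y 0 = 0 := by rw [C.apply_zero y hysrc, hu0]
    have hz1 : C.Θ y 1 = 0 := by rw [C.apply_one y hysrc, hv0]
    show I₁ (C.Θ y) = _
    rw [hI₁]
    dsimp only
    rw [hadamard_integral_of_stratum hz0 hz1 1]
    -- `w = g` near `C.Θ y`
    have hev : w =ᶠ[𝓝 (C.Θ y)] g := by
      filter_upwards [Metric.isOpen_ball.mem_nhds hy.2] with z hz using hweq z hz
    rw [hev.fderiv_eq]

/-- **The collar coefficient of a face.**  Let `Q ∩ U = {u_a = 0, 0 ≤ v_a}`,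
`F ∩ U = {u_a = v_a = 0}` (`F ⊆ U` compact, `Q` closed), corner-slice charts along `F`, and
`G₁` smooth with `G₁ = 1` on `F`, `G₁ < 1` on `Q ∖ F`, and *regular across `F` along `Q`* in
the sense that no smooth `λ` with `G₁ = 1 - v_a λ` on `Q` near a point `x ∈ F` can vanish at
`x`.  Then there are a smooth `λ : X → ℝ` and an open `Oλ`, `F ⊆ Oλ ⊆ U`, with `λ > 0` on `Oλ`
and `G₁ = 1 - v_a · λ` on `Q ∩ Oλ`: the local Hadamard coefficients
(`exists_faceHadamard_local`), which on `Q ∖ F` all equal `(1 - G₁)/v_a`, glued under this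
pointwise constraint by a smooth partition of unity. [cite: Milnor1963, Lemma 2.1] -/
theorem exists_faceCollar [CompactSpace X] {U : Set X} (hUo : IsOpen U) {ua va : X → ℝ}
    (hvas : ContMDiff (𝓡 4) 𝓘(ℝ, ℝ) ∞ va)
    {F Q Sa : Set X} {ρ : X → X} (hFc : IsCompact F) (hFU : F ⊆ U) (hQc : IsClosed Q)
    (hmemF : ∀ y ∈ U, y ∈ F ↔ ua y = 0 ∧ va y = 0) (hQU : ∀ y ∈ U, y ∈ Q ↔ ua y = 0 ∧ 0 ≤ va y)
    (hcorner : ∀ x ∈ F, ∃ C : CornerSliceChart Sa F ua va ρ, x ∈ C.Θ.source ∧ C.Θ.source ⊆ U)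
    {G₁ : X → ℝ} (hG₁s : ContMDiff (𝓡 4) 𝓘(ℝ, ℝ) ∞ G₁) (hG₁F : ∀ y ∈ F, G₁ y = 1)
    (hG₁lt : ∀ y ∈ Q, y ∉ F → G₁ y < 1)
    (hreg : ∀ x ∈ F, ∀ lam : X → ℝ, ContMDiff (𝓡 4) 𝓘(ℝ, ℝ) ∞ lam →
      (∀ᶠ y in 𝓝 x, y ∈ Q → G₁ y = 1 - va y * lam y) → lam x ≠ 0) :
    ∃ (lam : X → ℝ) (Ol : Set X), ContMDiff (𝓡 4) 𝓘(ℝ, ℝ) ∞ lam ∧ IsOpen Ol ∧ F ⊆ Ol ∧ Ol ⊆ U ∧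
      (∀ y ∈ Ol, 0 < lam y) ∧ ∀ y ∈ Q ∩ Ol, G₁ y = 1 - va y * lam y := by
  -- a neighbourhood `U'` of `F` with closure in `U`
  obtain ⟨U', hU'o, hFU', hclU'⟩ := normal_exists_closure_subset hFc.isClosed hUo hFU
  -- ### the constraint and the local solutions
  set t : X → Set ℝ := fun y => {r | y ∈ Q → y ∈ U' → va y ≠ 0 → r = (1 - G₁ y) / va y} with ht
  have hconv : ∀ y, Convex ℝ (t y) := by
    intro y
    by_cases hy : y ∈ Q ∧ y ∈ U' ∧ va y ≠ 0
    · have : t y = {(1 - G₁ y) / va y} := by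
        ext r; simp only [ht, mem_setOf_eq, mem_singleton_iff]
        exact ⟨fun h => h hy.1 hy.2.1 hy.2.2, fun h _ _ _ => h⟩
      rw [this]; exact convex_singleton _
    · have : t y = univ := by
        ext r; simp only [ht, mem_setOf_eq, mem_univ, iff_true]
        intro h1 h2 h3; exact absurd ⟨h1, h2, h3⟩ hy
      rw [this]; exact convex_univ
  have hquot : ∀ {V : Set X}, IsOpen V → (∀ y ∈ V, va y ≠ 0) →
      ContMDiffOn (𝓡 4) 𝓘(ℝ, ℝ) ∞ (fun y => (1 - G₁ y) / va y) V := by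
    intro V hV hne
    exact (contMDiff_const.sub hG₁s).contMDiffOn.div₀ hvas.contMDiffOn hne
  obtain ⟨g, hg⟩ : ∃ g : C^∞⟮𝓡 4, X; 𝓘(ℝ, ℝ), ℝ⟯, ∀ y, g y ∈ t y := by
    refine exists_contMDiffMap_forall_mem_convex_of_local (I := 𝓡 4) hconv fun y₀ => ?_
    by_cases hy₀F : y₀ ∈ F
    · -- Hadamard coefficient near a point of `F`
      obtain ⟨C, hy₀C, hCU⟩ := hcorner y₀ hy₀F
      obtain ⟨N, A, B, hNo, hy₀N, hNC, hAs, -, hid, -⟩ :=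
        exists_faceHadamard_local C hG₁s (fun y _ hyF => hG₁F y hyF) hy₀C
      refine ⟨N, hNo.mem_nhds hy₀N, A, hAs, fun y hy hyQ _ hva => ?_⟩
      have hyU : y ∈ U := hCU (hNC hy)
      have hu0 : ua y = 0 := ((hQU y hyU).1 hyQ).1
      have h := hid y hy
      rw [hu0, zero_mul, zero_add] at h
      field_simp
      linarith
    · by_cases hy₀Q : y₀ ∈ Q
      · by_cases hy₀cl : y₀ ∈ closure U'
        · have hy₀U : y₀ ∈ U := hclU' hy₀cl
          have hva₀ : va y₀ ≠ 0 := by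
            intro h0
            exact hy₀F ((hmemF y₀ hy₀U).2 ⟨((hQU y₀ hy₀U).1 hy₀Q).1, h0⟩)
          set V : Set X := U ∩ {y | va y ≠ 0} with hV
          have hVo : IsOpen V := hUo.inter (isOpen_ne_fun hvas.continuous continuous_const)
          refine ⟨V, hVo.mem_nhds ⟨hy₀U, hva₀⟩, fun y => (1 - G₁ y) / va y,
            hquot hVo (fun y hy => hy.2), fun y _ _ _ _ => rfl⟩
        · refine ⟨(closure U')ᶜ, isClosed_closure.isOpen_compl.mem_nhds hy₀cl, fun _ => 0,
            contMDiffOn_const, fun y hy _ hyU' _ => absurd (subset_closure hyU') hy⟩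
      · exact ⟨Qᶜ, hQc.isOpen_compl.mem_nhds hy₀Q, fun _ => 0, contMDiffOn_const,
          fun y hy hyQ _ _ => absurd hyQ hy⟩
  -- ### the glued coefficient
  set lam : X → ℝ := fun y => g y with hlam
  have hlams : ContMDiff (𝓡 4) 𝓘(ℝ, ℝ) ∞ lam := g.contMDiff
  have hid : ∀ y ∈ Q, y ∈ U' → G₁ y = 1 - va y * lam y := by
    intro y hyQ hyU'
    by_cases hva : va y = 0
    · have hyU : y ∈ U := hclU' (subset_closure hyU')
      have hyF : y ∈ F := (hmemF y hyU).2 ⟨((hQU y hyU).1 hyQ).1, hva⟩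
      rw [hG₁F y hyF, hva, zero_mul, sub_zero]
    · have h : lam y = (1 - G₁ y) / va y := hg y hyQ hyU' hva
      rw [h]
      field_simp
      ring
  -- ### positivity on `F`
  have hpos : ∀ x ∈ F, 0 < lam x := by
    intro x hxF
    have hne : lam x ≠ 0 := by
      refine hreg x hxF lam hlams ?_
      filter_upwards [hU'o.mem_nhds (hFU' hxF)] with y hyU' hyQ using hid y hyQ hyU'
    -- nonnegativity: approach `x` inside `Q ∖ F` along the chart direction `e₁`
    obtain ⟨C, hxC, hCU⟩ := hcorner x hxF
    set z₀ : EuclideanSpace ℝ (Fin 4) := C.Θ x with hz₀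
    have hz₀T : z₀ ∈ C.Θ.target := C.Θ.map_source hxC
    obtain ⟨hu0, hv0⟩ := (hmemF x (hFU hxF)).1 hxF
    have hz₀0 : z₀ 0 = 0 := by rw [hz₀, C.apply_zero x hxC, hu0]
    have hz₀1 : z₀ 1 = 0 := by rw [hz₀, C.apply_one x hxC, hv0]
    set γ : ℝ → X := fun s => C.Θ.symm (z₀ + s • EuclideanSpace.single 1 (1:ℝ)) with hγ
    have hcurve : Tendsto (fun s : ℝ => z₀ + s • EuclideanSpace.single (1 : Fin 4) (1:ℝ)) (𝓝 0) (𝓝 z₀) := by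
      have : Continuous fun s : ℝ => z₀ + s • EuclideanSpace.single (1 : Fin 4) (1:ℝ) := by fun_prop
      simpa using this.tendsto 0
    have hγt : Tendsto γ (𝓝[>] 0) (𝓝 x) := by
      have h2 : ContinuousAt C.Θ.symm z₀ := C.Θ.continuousAt_symm hz₀T
      have h3 := h2.tendsto.comp hcurve
      rw [hz₀, C.Θ.left_inv hxC] at h3
      exact h3.mono_left nhdsWithin_le_nhds
    have hev : ∀ᶠ s in 𝓝[>] (0:ℝ), 0 < lam (γ s) := by
      have hT : ∀ᶠ s in 𝓝[>] (0:ℝ), z₀ + s • EuclideanSpace.single (1 : Fin 4) (1:ℝ) ∈ C.Θ.target :=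
        (hcurve.eventually (C.Θ.open_target.mem_nhds hz₀T)).filter_mono nhdsWithin_le_nhds
      have hU'γ : ∀ᶠ s in 𝓝[>] (0:ℝ), γ s ∈ U' := hγt.eventually (hU'o.mem_nhds (hFU' hxF))
      filter_upwards [hT, hU'γ, self_mem_nhdsWithin] with s hsT hsU' hs0
      have hs0' : (0:ℝ) < s := hs0
      have hysrc : γ s ∈ C.Θ.source := C.Θ.map_target hsT
      have hΘγ : C.Θ (γ s) = z₀ + s • EuclideanSpace.single (1 : Fin 4) (1:ℝ) := C.Θ.right_inv hsT
      have huγ : ua (γ s) = 0 := by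
        rw [← C.apply_zero _ hysrc, hΘγ]; simp [hz₀0]
      have hvγ : va (γ s) = s := by
        rw [← C.apply_one _ hysrc, hΘγ]; simp [hz₀1]
      have hyU : γ s ∈ U := hCU hysrc
      have hyQ : γ s ∈ Q := (hQU _ hyU).2 ⟨huγ, by rw [hvγ]; exact hs0'.le⟩
      have hyF : γ s ∉ F := fun h => by
        have := ((hmemF _ hyU).1 h).2; rw [hvγ] at this; exact hs0'.ne' this
      have hlt := hG₁lt _ hyQ hyF
      have h := hid _ hyQ hsU'
      rw [hvγ] at h
      -- `G₁ = 1 - s · lam < 1` with `s > 0`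
      nlinarith
    have hge : 0 ≤ lam x :=
      ge_of_tendsto ((hlams.continuous.tendsto x).comp hγt) (hev.mono fun s hs => hs.le)
    exact lt_of_le_of_ne hge (Ne.symm hne)
  -- ### the open set
  set Ol : Set X := U' ∩ {y | 0 < lam y} with hOl
  have hOlo : IsOpen Ol := hU'o.inter (isOpen_lt continuous_const hlams.continuous)
  refine ⟨lam, Ol, hlams, hOlo, fun x hx => ⟨hFU' hx, hpos x hx⟩,
    fun y hy => hclU' (subset_closure hy.1), fun y hy => hy.2, fun y hy => hid y hy.1 hy.2.1⟩

omit [T2Space X] [IsManifold (𝓡 4) ∞ X] [IsManifold (𝓡∂ 3) ∞ H] in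
/-- **Regularity across `F` along the face comes from the adapted Morse function.**  If
`G₁ ∘ e = f` with `f` adapted to `∂H`, `e(∂H) = F`, `v_a = 0` on `F`, and near a point `x ∈ F`
one has `G₁ = 1 - v_a · λ` on the face for a smooth `λ`, then `λ x ≠ 0`: otherwise
`f = 1 - (v_a ∘ e)(λ ∘ e)` near `w₀ = e⁻¹ x` would be critical at the boundary point `w₀`
(product rule), contradicting adaptedness. [cite: MilnorHCobordism1965, Def. 3.1] -/
theorem face_collar_regular {e : H → X} (he : ContMDiff (𝓡∂ 3) (𝓡 4) ∞ e) {Q F : Set X}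
    (hQ : range e = Q) (hbd : e '' (𝓡∂ 3).boundary H = F)
    {f : H → ℝ} (hf : IsMorseAdapted (𝓡∂ 3) f) {G₁ : X → ℝ} (hG₁f : ∀ w, G₁ (e w) = f w)
    {va : X → ℝ} (hvas : ContMDiff (𝓡 4) 𝓘(ℝ, ℝ) ∞ va) (hvaF : ∀ y ∈ F, va y = 0) :
    ∀ x ∈ F, ∀ lam : X → ℝ, ContMDiff (𝓡 4) 𝓘(ℝ, ℝ) ∞ lam →
      (∀ᶠ y in 𝓝 x, y ∈ Q → G₁ y = 1 - va y * lam y) → lam x ≠ 0 := by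
  intro x hxF lam hlams hev hlam0
  obtain ⟨w₀, hw₀bd, rfl⟩ : ∃ w₀ ∈ (𝓡∂ 3).boundary H, e w₀ = x := by
    rw [← hbd] at hxF; exact hxF
  have hreg : ¬ IsMCriticalPt (𝓡∂ 3) f w₀ := (hf.2.1 w₀ hw₀bd).2
  apply hreg
  -- `f = 1 - (va ∘ e) * (lam ∘ e)` near `w₀`
  have hev' : f =ᶠ[𝓝 w₀] fun w => 1 - (va ∘ e) w * (lam ∘ e) w := by
    have h1 := (he.continuous.continuousAt (x := w₀)).eventually hev
    filter_upwards [h1] with w hw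
    rw [← hG₁f w]
    exact hw (hQ ▸ mem_range_self w)
  have hc : MDifferentiableAt (𝓡∂ 3) 𝓘(ℝ, ℝ) (va ∘ e) w₀ :=
    ((hvas.comp he).mdifferentiableAt (by simp))
  have hk : MDifferentiableAt (𝓡∂ 3) 𝓘(ℝ, ℝ) (lam ∘ e) w₀ :=
    ((hlams.comp he).mdifferentiableAt (by simp))
  have hprod := hc.hasMFDerivAt.mul hk.hasMFDerivAt
  have hc0 : (va ∘ e) w₀ = 0 := hvaF _ hxF
  have hk0 : (lam ∘ e) w₀ = 0 := hlam0
  rw [hc0, hk0, zero_smul, zero_smul, add_zero] at hprod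
  have hconst : HasMFDerivAt (𝓡∂ 3) 𝓘(ℝ, ℝ) (fun _ : H => (1:ℝ)) w₀ 0 := hasMFDerivAt_const _ _
  have hsub := hconst.sub hprod
  rw [sub_zero] at hsub
  have hf' : HasMFDerivAt (𝓡∂ 3) 𝓘(ℝ, ℝ) f w₀ 0 := hsub.congr_of_eventuallyEq hev'
  exact hf'.mfderiv

omit [T2Space X] in
/-- **The collar function is regular at the boundary points of the face.**  In the structure
of a boundary slice atlas `Φ` of `Q` whose chart at `p` has `0`-th coordinate `v_a`, with
`v_a p = 0`, a function `G = 1 - v_a · λ` near `p.1` with `λ p.1 ≠ 0` restricts to a function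
on `Q` which is not critical at `p`: written in the chart it is `1 - z₀ · ℓ(z)` near the image
point (where `z₀ = 0`), whose derivative within the half-space is `-ℓ · dz₀ ≠ 0`.
[cite: Milnor1963, §2; LeeSmoothManifolds2013, Thm. 5.51] -/
theorem not_isMCriticalPt_face_boundary {Q : Set X} (Φ : BoundarySliceAtlas 2 Q) (p : ↥Q)
    {va G lam : X → ℝ} (hD0 : ∀ q ∈ (Φ.datum p).Θ.source, (Φ.datum p).Θ q 0 = va q)
    (hp0 : va p.1 = 0)
    (hGs : ContMDiff (𝓡 4) 𝓘(ℝ, ℝ) ∞ G) (hlams : ContMDiff (𝓡 4) 𝓘(ℝ, ℝ) ∞ lam)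
    (hGform : ∀ᶠ y in 𝓝 p.1, G y = 1 - va y * lam y) (hlam : lam p.1 ≠ 0) :
    letI := Φ.chartedSpace
    ¬ IsMCriticalPt (𝓡∂ 3) (G ∘ Subtype.val : ↥Q → ℝ) p := by
  letI := Φ.chartedSpace
  haveI := Φ.isManifold
  set D := Φ.datum p with hD
  have hpD : p.1 ∈ D.Θ.source := Φ.mem_source p
  have hGval : ContMDiff (𝓡∂ 3) 𝓘(ℝ, ℝ) ∞ (G ∘ Subtype.val : ↥Q → ℝ) := hGs.comp Φ.contMDiff_subtype_val
  have hmd : MDifferentiableAt (𝓡∂ 3) 𝓘(ℝ, ℝ) (G ∘ Subtype.val : ↥Q → ℝ) p :=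
    hGval.mdifferentiableAt (by simp)
  rw [isMCriticalPt_iff_fderivWithin_writtenInExtChartAt_eq_zero (I := 𝓡∂ 3)
    (mem_extChartAt_source (I := 𝓡∂ 3) p) hmd]
  -- ### the point and the written function
  set z₀ : EuclideanSpace ℝ (Fin 3) := extChartAt (𝓡∂ 3) p p with hz₀
  have hz₀eq : z₀ = dropLast 2 (D.Θ p.1) := Φ.extChartAt_self_apply p
  have hsnoc₀ : snocEquiv 3 (z₀, 0) = D.Θ p.1 := by
    rw [hz₀eq]; exact D.snocEquiv_dropLast_apply hpD p.2
  have hz₀0 : z₀ 0 = 0 := by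
    rw [hz₀eq, dropLast_apply_zero, hD0 _ hpD]; exact hp0
  have hz₀range : z₀ ∈ range (𝓡∂ 3) :=
    extChartAt_target_subset_range (I := 𝓡∂ 3) p ((extChartAt (𝓡∂ 3) p).map_source
      (mem_extChartAt_source (I := 𝓡∂ 3) p))
  have hext : extChartAt (𝓡∂ 3) p = (D.chart p).extend (𝓡∂ 3) := rfl
  -- the model function `ψ z = G (Θ⁻¹ (z, 0))`
  set σ : EuclideanSpace ℝ (Fin 3) → EuclideanSpace ℝ (Fin 4) := fun z => snocEquiv 3 (z, 0) with hσ
  have hσs : ContDiff ℝ ∞ σ := by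
    have : ContDiff ℝ ∞ fun z : EuclideanSpace ℝ (Fin 3) => (z, (0:ℝ)) := contDiff_id.prodMk contDiff_const
    exact (snocEquiv 3).contDiff.comp this
  set T : Set (EuclideanSpace ℝ (Fin 3)) := σ ⁻¹' D.Θ.target with hT
  have hTo : IsOpen T := D.Θ.open_target.preimage hσs.continuous
  have hz₀T : z₀ ∈ T := by
    show snocEquiv 3 (z₀, 0) ∈ D.Θ.target
    rw [hsnoc₀]; exact D.Θ.map_source hpD
  set ψ : EuclideanSpace ℝ (Fin 3) → ℝ := fun z => G (D.Θ.symm (σ z)) with hψ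
  -- the written function agrees with `ψ` on the half-space part of `T`
  have hwritten : ∀ z ∈ T, 0 ≤ z 0 →
      writtenInExtChartAt (𝓡∂ 3) 𝓘(ℝ, ℝ) p (G ∘ Subtype.val : ↥Q → ℝ) z = ψ z := by
    intro z hzT hz0
    simp only [writtenInExtChartAt, extChartAt_model_space_eq_id, PartialEquiv.refl_coe, id_eq,
      comp_apply]
    rw [hext, D.coe_extend_chart_symm_of_mem hz0 hzT]
  have hagree : writtenInExtChartAt (𝓡∂ 3) 𝓘(ℝ, ℝ) p (G ∘ Subtype.val : ↥Q → ℝ)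
      =ᶠ[𝓝[range (𝓡∂ 3)] z₀] ψ := by
    have h1 : ∀ᶠ z in 𝓝[range (𝓡∂ 3)] z₀, z ∈ T :=
      Filter.Eventually.filter_mono nhdsWithin_le_nhds (hTo.mem_nhds hz₀T)
    filter_upwards [h1, self_mem_nhdsWithin] with z hzT hzr
    rw [range_modelWithCornersEuclideanHalfSpace] at hzr
    exact hwritten z hzT hzr
  have hval : writtenInExtChartAt (𝓡∂ 3) 𝓘(ℝ, ℝ) p (G ∘ Subtype.val : ↥Q → ℝ) z₀ = ψ z₀ :=
    hwritten z₀ hz₀T (by rw [hz₀0])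
  rw [hagree.fderivWithin_eq hval]
  -- ### `ψ = 1 - z₀ · ℓ` near `z₀`
  set ℓ : EuclideanSpace ℝ (Fin 3) → ℝ := fun z => lam (D.Θ.symm (σ z)) with hℓ
  have hsymm_cont : ContinuousAt (fun z => D.Θ.symm (σ z)) z₀ :=
    (D.Θ.continuousAt_symm (by exact hz₀T)).comp hσs.continuous.continuousAt
  have hsymm₀ : D.Θ.symm (σ z₀) = p.1 := by
    show D.Θ.symm (snocEquiv 3 (z₀, 0)) = p.1
    rw [hsnoc₀, D.Θ.left_inv hpD]
  have hvaσ : ∀ z ∈ T, va (D.Θ.symm (σ z)) = z 0 := by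
    intro z hzT
    have hsrc : D.Θ.symm (σ z) ∈ D.Θ.source := D.Θ.map_target hzT
    rw [← hD0 _ hsrc, D.Θ.right_inv hzT]
    show snocEquiv 3 (z, 0) 0 = z 0
    exact snocEquiv_apply_zero 3 (z, 0)
  have hψφ : ψ =ᶠ[𝓝 z₀] fun z => 1 - z 0 * ℓ z := by
    have h1 : ∀ᶠ z in 𝓝 z₀, G (D.Θ.symm (σ z)) = 1 - va (D.Θ.symm (σ z)) * lam (D.Θ.symm (σ z)) := by
      have hG' : ∀ᶠ y in 𝓝 (D.Θ.symm (σ z₀)), G y = 1 - va y * lam y := by rw [hsymm₀]; exact hGform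
      exact hsymm_cont.eventually (p := fun y => G y = 1 - va y * lam y) hG'
    filter_upwards [h1, hTo.mem_nhds hz₀T] with z hz hzT
    simp only [hψ, hℓ, hz, hvaσ z hzT]
  -- ### the derivative
  have hℓd : DifferentiableAt ℝ ℓ z₀ := by
    have h1 : ContMDiffOn 𝓘(ℝ, EuclideanSpace ℝ (Fin 4)) 𝓘(ℝ, ℝ) ∞ (lam ∘ D.Θ.symm) D.Θ.target :=
      hlams.comp_contMDiffOn D.contMDiffOn_symm
    have h2 : ContDiffOn ℝ ∞ ℓ T := (contMDiffOn_iff_contDiffOn.1 h1).comp hσs.contDiffOn fun z hz => hz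
    exact (h2.differentiableOn (by simp)).differentiableAt (hTo.mem_nhds hz₀T)
  have hproj : HasFDerivAt (fun z : EuclideanSpace ℝ (Fin 3) => z 0)
      (EuclideanSpace.proj (0 : Fin 3) : EuclideanSpace ℝ (Fin 3) →L[ℝ] ℝ) z₀ :=
    (EuclideanSpace.proj (0 : Fin 3) : EuclideanSpace ℝ (Fin 3) →L[ℝ] ℝ).hasFDerivAt
  have hφd : HasFDerivAt (fun z : EuclideanSpace ℝ (Fin 3) => 1 - z 0 * ℓ z)
      (0 - (z₀ 0 • fderiv ℝ ℓ z₀ + ℓ z₀ • (EuclideanSpace.proj (0 : Fin 3) : EuclideanSpace ℝ (Fin 3) →L[ℝ] ℝ))) z₀ :=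
    (hasFDerivAt_const (1:ℝ) z₀).sub (hproj.mul hℓd.hasFDerivAt)
  have hψd : HasFDerivAt ψ
      (0 - (z₀ 0 • fderiv ℝ ℓ z₀ + ℓ z₀ • (EuclideanSpace.proj (0 : Fin 3) : EuclideanSpace ℝ (Fin 3) →L[ℝ] ℝ))) z₀ :=
    hφd.congr_of_eventuallyEq hψφ
  have huniq : UniqueDiffWithinAt ℝ (range (𝓡∂ 3)) z₀ := (𝓡∂ 3).uniqueDiffOn z₀ hz₀range
  rw [hψd.hasFDerivWithinAt.fderivWithin huniq, hz₀0, zero_smul, zero_add, zero_sub]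
  intro h0
  have h1 := congrArg (fun L : EuclideanSpace ℝ (Fin 3) →L[ℝ] ℝ => L (EuclideanSpace.single 0 1)) h0
  have hℓ₀ : ℓ z₀ = lam p.1 := by simp only [hℓ, hsymm₀]
  simp only [neg_apply, smul_apply, smul_eq_mul, zero_apply, neg_eq_zero] at h1
  rw [hℓ₀] at h1
  have h2 : (EuclideanSpace.proj (0 : Fin 3) : EuclideanSpace ℝ (Fin 3) →L[ℝ] ℝ)
      (EuclideanSpace.single 0 1) = 1 := by simp [EuclideanSpace.single]
  rw [h2, mul_one] at h1
  exact hlam h1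

end FaceAmbient

end Literature.Topology.FourManifolds
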